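import Summits.AtomisticToContinuum.FouriersLaw.Theorems.JunctionLocalityNonBallisticOfNoTruncatedDrude
import Summits.AtomisticToContinuum.FouriersLaw.Theses.NoHiddenChargesKubo

/-!
# Mock glue certificate (strategist r1, crux stmt-AtomisticToContinuum-9127, route JunctionLocality)

The 2-way dedup split `NonBallistic ⟸ ExtensiveSnapshotIrreversibility (= stmt-9121) ∧ NoTruncatedDrude (= stmt-11030)`.
Children are stated here with the byte-identical ledger texts; `child₁_iff` / `child₂_iff` show the dedup is exact (`Iff.rfl`);
`nonBallisticOfDrudeSubs_closes` is the CLOSING TERM of the glue item the gate generates (`--glue-decl-name NonBallisticOfDrudeSubs`):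
the landed deciding reduction `Theorems.NonBallistic.nonBallistic_of_extensiveSnapshotIrreversibility_of_noTruncatedDrude` (p156168, lead c3).
A `--glue-by` link is impossible on this route: that theorem's module imports `Theses.JunctionLocality` (it concludes the route decl BY NAME),
so rendering `_root_.…` inside the route file is `glue.cyclic-import`; hence glue as ITEM + this one-liner for a prover
(`Theorems/JunctionLocalityNonBallisticOfDrudeSubs.lean --workitem <glue item>`). Expected: rc 0, 0 sorries, standard axioms.
-/

namespace Summit.AtomisticToContinuum.FouriersLaw.Theses.JunctionLocality.SplitR1Mock

open scoped BigOperators Topology Manifold Classical MeasureTheory ProbabilityTheory Matrix InnerProductSpace ComplexConjugate ContinuousMap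
open Filter Set Function TopologicalSpace MeasureTheory

/-- child 1 (= stmt-9121 verbatim) -/
def ExtensiveSnapshotIrreversibility : Prop :=
  ∀ ω₂ lam β γ : ℝ, 0 < ω₂ → 0 < lam → 0 < β → 0 < γ → (∀ (N : ℕ) (T_L T_R : ℝ), 0 < T_L → 0 < T_R → ∀ μ ν : MeasureTheory.Measure (Literature.MathematicalPhysics.KineticTheory.HeatConduction.PhaseSpace N), (Literature.MathematicalPhysics.KineticTheory.HeatConduction.pinnedChain ω₂ lam β γ).IsSteadyState N T_L T_R μ → (Literature.MathematicalPhysics.KineticTheory.HeatConduction.pinnedChain ω₂ lam β γ).IsSteadyState N T_L T_R ν → μ = ν) → ∀ μ : (N : ℕ) → ℝ → ℝ → MeasureTheory.Measure (Literature.MathematicalPhysics.KineticTheory.HeatConduction.PhaseSpace N), (∀ (N : ℕ) (T_L T_R : ℝ), 0 < T_L → 0 < T_R → (Literature.MathematicalPhysics.KineticTheory.HeatConduction.pinnedChain ω₂ lam β γ).IsSteadyState N T_L T_R (μ N T_L T_R)) → ∀ T : ℝ, 0 < T → ∃ C : ℝ, ∀ N : ℕ, ∀ᶠ δ in nhdsWithin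 (0 : ℝ) {(0 : ℝ)}ᶜ, InformationTheory.klDiv (μ N (T + δ / 2) (T - δ / 2)) (MeasureTheory.Measure.map (fun x : Literature.MathematicalPhysics.KineticTheory.HeatConduction.PhaseSpace N => (x.1, -x.2)) (μ N (T + δ / 2) (T - δ / 2))) ≤ ENNReal.ofReal (C * (N : ℝ) * δ ^ 2)

/-- child 2 (= stmt-11030 verbatim) -/
def NoTruncatedDrude : Prop :=
  ∀ ω₂ lam β γ : ℝ, 0 < ω₂ → 0 < lam → 0 < β → ∀ T : ℝ, 0 < T → ∀ μ : MeasureTheory.Measure Literature.MathematicalPhysics.KineticTheory.HeatConduction.ChainConfig, (Literature.MathematicalPhysics.KineticTheory.HeatConduction.pinnedChain ω₂ lam β γ).IsChainGibbsMeasure T μ → Literature.MathematicalPhysics.KineticTheory.HeatConduction.IsShiftInvariant μ → μ.map (fun σ : Literature.MathematicalPhysics.KineticTheory.HeatConduction.ChainConfig => fun x : ℤ => ((σ x).1, -(σ x).2)) = μ → ∀ D : Literature.MathematicalPhysics.KineticTheory.HeatConduction.InfiniteChainDynamics (Literature.MathematicalPhysics.KineticTheory.HeatConduction.pinnedChain ω₂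 lam β γ), D.PreservesMeasure μ → (∀ t : ℝ, ∀ᵐ σ ∂μ, D.flow t (Literature.MathematicalPhysics.KineticTheory.HeatConduction.shift σ) = Literature.MathematicalPhysics.KineticTheory.HeatConduction.shift (D.flow t σ)) → ∀ M : ℝ, 0 < M → ∀ F : ℝ → ℝ, F = (fun u : ℝ => max (-M) (min M u)) → ∀ η : ℝ, 0 < η → ∃ τ₀ : ℝ, ∀ τ : ℝ, τ₀ ≤ τ → ∃ L₀ : ℕ, ∀ L : ℕ, L₀ ≤ L → ∀ G : Literature.MathematicalPhysics.KineticTheory.HeatConduction.ChainConfig → ℝ, G = (fun σ : Literature.MathematicalPhysics.KineticTheory.HeatConduction.ChainConfig => ∑ x ∈ Finset.Icc (-(L : ℤ)) (L : ℤ), F ((Literature.MathematicalPhysics.KineticTheory.HeatConduction.pinnedChain ω₂ lam β γ).bondCurrentZ σ x)) → |(τ⁻¹ * ∫ t in (0:ℝ)..τ, ((∫ σ, F ((Literature.MathematicalPhysics.KineticTheory.HeatConduction.pinnedChain ω₂ lam β γ).bondCurrentZ (D.flow t σ) 0) * G σ ∂μ) - (∫ σ, F ((Literature.MathematicalPhysics.KineticTheory.HeatConduction.pinnedChain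 ω₂ lam β γ).bondCurrentZ (D.flow t σ) 0) ∂μ) * (∫ σ, G σ ∂μ)))| ≤ η

/-- mock of the generated glue item -/
def NonBallisticOfDrudeSubs : Prop :=
  ExtensiveSnapshotIrreversibility → NoTruncatedDrude →
    Summit.AtomisticToContinuum.FouriersLaw.Theses.JunctionLocality.NonBallistic

theorem child₁_iff :
    ExtensiveSnapshotIrreversibility ↔
      Summit.AtomisticToContinuum.FouriersLaw.Theses.BondHeatUncertainty.ExtensiveSnapshotIrreversibility := Iff.rfl

theorem child₂_iff :
    NoTruncatedDrude ↔ Summit.AtomisticToContinuum.FouriersLaw.Theses.CurrentTiltQuench.NoTruncatedDrude := Iff.rfl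

theorem child₂_iff' :
    NoTruncatedDrude ↔ Summit.AtomisticToContinuum.FouriersLaw.Theses.NoHiddenChargesKubo.NoTruncatedDrude := Iff.rfl

/-- the shared parent: JunctionLocality's copy IS BondHeatUncertainty's copy (one ledger item stmt-9127) -/
theorem parent_iff :
    Summit.AtomisticToContinuum.FouriersLaw.Theses.JunctionLocality.NonBallistic ↔
      Summit.AtomisticToContinuum.FouriersLaw.Theses.BondHeatUncertainty.NonBallistic := Iff.rfl

/-- CLOSING TERM of the glue item (what a prover lands verbatim against the re-rendered route file). -/
theorem nonBallisticOfDrudeSubs_closes : NonBallisticOfDrudeSubs :=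
  fun hK h30 =>
    Summit.AtomisticToContinuum.FouriersLaw.Theorems.NonBallistic.nonBallistic_of_extensiveSnapshotIrreversibility_of_noTruncatedDrude
      hK h30

/-- the same glue by term with the binders in the gate's render order (children sorted by item id: 9121 < 11030 — same order). -/
theorem glue_by_term :
    ExtensiveSnapshotIrreversibility → NoTruncatedDrude →
      Summit.AtomisticToContinuum.FouriersLaw.Theses.JunctionLocality.NonBallistic :=
  Summit.AtomisticToContinuum.FouriersLaw.Theorems.NonBallistic.nonBallistic_of_extensiveSnapshotIrreversibility_of_noTruncatedDrude

end Summit.AtomisticToContinuum.FouriersLaw.Theses.JunctionLocality.SplitR1Mock
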